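import Summits.Ventures.QEC.Thresholds.RotatedSurfaceCodeSAWThresholds
import Summits.Ventures.QEC.Thresholds.RotatedSurfaceCodeSAWThresholdsZ
import Summits.Ventures.QEC.Thresholds.PlanarSurfaceCodePhenomSAWBox
import Literature.InformationTheory.QuantumCodes.RotatedSurfaceCodeSpaceTimeInhomogeneous
import HarnessLib
-- buildfix (bf3-g30) G30-28: comment-only touch to re-dispatch the lane build (dead-lettered rc 76 (att 7, last 20:24 08-27 / 06:01 08-28) behind Literature.InformationTheory.QuantumCodes.ToricCodeErasureHalfGeometry whose hub olean is fresh; root and file farm rc 0 now (lane datum: host-local stale dependency olean); no build event for 9-19 h); declarations byte-identical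

/-!
# Rotated surface codes under INHOMOGENEOUS space-time noise (every qubit fault and every measurement fault of every round
# independent with its own rate `≤ ρ`): below threshold for every `ρ < p₀(4.7476)`, in particular `ρ ≤ .0112`, both sectors,
# every minimum-weight space-time decoder family — unconditional, tier CERTIFIED (kernel), failure-sum form

Venture QEC, `Summits/Ventures/QEC/Thresholds/` (LADDER-QEC rung Q5, PARTITION row 09 "phenomenological"; qec-type-09 gen 7, line
D50.L6 «L-PHENOM» / item «09.RSCPH», inhomogeneous form). The two-rate model `(p, q)` of the other files of this line is the special
case `r = phenomRate p q`. Here the fault rates may depend on the qubit, the check AND the round (drifting, non-uniform hardware;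
lit-2's `indepWeight`), as long as all of them are `≤ ρ`; the statements are FAILURE SUMS `Σ_{E : D fails on E} w_r(E)` (no
threshold VALUE is defined for a rate field), proved from `RotatedSurfaceCodeSpaceTimeInhomogeneous.lean`
(`Σ ≤ L·T·C·r^L/(1-r)` under `cₙ(ℤ³) ≤ C νⁿ`, `r = 2ν√(ρ(1-ρ))`).

| theorem | statement | tier |
|---|---|---|
| `rsc_z_stInhom_belowThreshold_of_sawCountBound3`, `rsc_x_stInhom_belowThreshold_of_sawCountBound3` | `cₙ(ℤ³) ≤ C νⁿ`, rates `≤ ρ ≤ 1/2`, `4ν² ρ(1-ρ) < 1` ⇒ failure sums `→ 0` (each sector, poly schedule, every minimum-weight space-time decoder family) | CERTIFIED (kernel), parametric |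
| `rsc_z_stInhom_belowThreshold_of_connectiveConstant_three_le`, `rsc_x_…` | `μ(ℤ³) ≤ μ'`, rates `≤ ρ < p₀(μ')` ⇒ `→ 0` | CERTIFIED (kernel), parametric |
| ★ `rsc_z_stInhom_belowThreshold_kernelZ3SymmK12`, ★ `rsc_x_stInhom_belowThreshold_kernelZ3SymmK12`, `rsc_stInhom_bothSectors_belowThreshold_0112` | rates `≤ ρ < p₀(4.7476)` — in particular **all rates `≤ .0112`** — ⇒ BOTH records of the rotated memory experiment have failure sums `→ 0`, every size `L` | CERTIFIED (kernel), unconditional |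

HONEST FRAMING. Certified statements about failure SUMS under a rate field bounded by `ρ`; sector-wise minimum-weight space-time
decoding; decimals from the kernel certificate `μ(ℤ³) ≤ 4.7476`. No `native_decide`, no named fact.

## References

* [DennisEtAl2002] E. Dennis, A. Kitaev, A. Landahl, J. Preskill, *Topological quantum memory*, J. Math. Phys. 43 (2002)
  4452–4505, arXiv:quant-ph/0110143, §4.2 (independent faults on the links of the space-time lattice), §5.2 eq. (28), §5.3 eqs.
  (saw_3), (threshold_iso), (threshold_iso_num).
* [PonitzTittmann2000] Electron. J. Combin. 7 (2000) R21, Table 2 (`d = 3, k = 12`).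
-/

noncomputable section

namespace Summit.Ventures.QEC.Thresholds

open Filter Topology Finset Matrix
open Literature.InformationTheory.QuantumCodes
open Literature.InformationTheory.QuantumCodes.RotatedSurface
open Literature.InformationTheory.QuantumCodes.ToricCode (SAWCountBound3 IsPolyBounded)
open Literature.Probability.RandomPlanarGeometry

/-! ### `H_X` sector -/

/-- (Private copy of `rsc_phenom_oddResidual_of_not_corrects` of `RotatedSurfaceCodePhenomSAWThresholds.lean`, restated here so
that this file imports only built modules.) Failure of the `H_X`-sector memory experiment ⇒ the projected residual has an odd
number of column-`0` qubits. [cite: DennisEtAl2002, §4.3 (success iff the residual is homologically trivial) and §6.1 (Π)] -/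
private theorem oddResidual_of_not_corrects_X {L : ℕ} (hL : 0 < L) (T : ℕ)
    {D : CSSPhenom.STDecoder (Fin (L + 1) × Fin (L - 1)) (Fin L × Fin L) T}
    (hD : D.IsMinWeight (CSSPhenom.stSyn (HX L) T) (CSSPhenom.stCycles (HX L) T) hammingNorm)
    {E : CSSPhenom.History (Fin (L + 1) × Fin (L - 1)) (Fin L × Fin L) T}
    (hfail : ¬ D.Corrects (CSSPhenom.stSyn (HX L) T)
      (CSSPhenom.stTrivial ((RotatedSurface.code L).rowSpZ : Set (Fin L × Fin L → ZMod 2)) T) E) :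
    ∑ i : Fin L, CSSPhenom.proj (D (CSSPhenom.stSyn (HX L) T E) + E) (i, ⟨0, hL⟩) = 1 :=
  rsc_colZero_eq_one hL (CSSPhenom.mulVec_proj_eq_zero (hD.add_mem E)) hfail

/-- (Private copy of `rsc_phenomZ_oddResidual_of_not_corrects` of `RotatedSurfaceCodePhenomSAWThresholdsZ.lean`.) Failure of the
`H_Z`-sector memory experiment ⇒ the projected residual has an odd number of row-`0` qubits.
[cite: DennisEtAl2002, §4.3 (success iff the residual is homologically trivial) and §6.1 (Π)] -/
private theorem oddResidual_of_not_corrects_Z {L : ℕ} (hL : 0 < L) (T : ℕ)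
    {D : CSSPhenom.STDecoder (Fin (L - 1) × Fin (L + 1)) (Fin L × Fin L) T}
    (hD : D.IsMinWeight (CSSPhenom.stSyn (HZ L) T) (CSSPhenom.stCycles (HZ L) T) hammingNorm)
    {E : CSSPhenom.History (Fin (L - 1) × Fin (L + 1)) (Fin L × Fin L) T}
    (hfail : ¬ D.Corrects (CSSPhenom.stSyn (HZ L) T)
      (CSSPhenom.stTrivial ((RotatedSurface.code L).rowSpX : Set (Fin L × Fin L → ZMod 2)) T) E) :
    ∑ j : Fin L, CSSPhenom.proj (D (CSSPhenom.stSyn (HZ L) T E) + E) (⟨0, hL⟩, j) = 1 :=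
  rsc_rowZero_eq_one hL (CSSPhenom.mulVec_proj_eq_zero (hD.add_mem E)) hfail


open Classical in
/-- **`H_X` sector, inhomogeneous space-time noise: failure sums `→ 0` when `4ν² ρ(1-ρ) < 1`** (`cₙ(ℤ³) ≤ C νⁿ`, `ν > 0`; every
polynomially bounded schedule `T`, every family `D i` of minimum-weight space-time decoders of the `X`-check record of `RSC(i+1)`,
every family of rate fields `r i` on the fault locations with `0 ≤ r i ℓ ≤ ρ ≤ 1/2`).
[cite: DennisEtAl2002, §5.3 eq. (threshold_iso) with §5.2 eq. (28) (p̃ at the largest rate)] -/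
theorem rsc_z_stInhom_belowThreshold_of_sawCountBound3 {C ν : ℝ} (hν : 0 < ν) (hC : SAWCountBound3 C ν) {T : ℕ → ℕ}
    (hT : IsPolyBounded T)
    (D : ∀ i, CSSPhenom.STDecoder (Fin (i + 1 + 1) × Fin (i + 1 - 1)) (Fin (i + 1) × Fin (i + 1)) (T i))
    (hD : ∀ i, (D i).IsMinWeight (CSSPhenom.stSyn (rscCode i).HX (T i)) (CSSPhenom.stCycles (rscCode i).HX (T i))
      hammingNorm)
    (r : ∀ i, HistoryLoc (Fin (i + 1) × Fin (i + 1)) (Fin (i + 1 + 1) × Fin (i + 1 - 1)) (T i) → ℝ) {ρ : ℝ}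
    (hρ0 : 0 ≤ ρ) (hr0 : ∀ i ℓ, 0 ≤ r i ℓ) (hrρ : ∀ i ℓ, r i ℓ ≤ ρ) (hρ : ρ ≤ 1 / 2)
    (h4 : 4 * ν ^ 2 * (ρ * (1 - ρ)) < 1) :
    Tendsto (fun i => ∑ E ∈ univ.filter (fun E : CSSPhenom.History (Fin (i + 1 + 1) × Fin (i + 1 - 1))
        (Fin (i + 1) × Fin (i + 1)) (T i) => ¬ (D i).Corrects (CSSPhenom.stSyn (rscCode i).HX (T i))
          (CSSPhenom.stTrivial ((rscCode i).rowSpZ : Set (Fin (i + 1) × Fin (i + 1) → ZMod 2)) (T i)) E),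
        indepWeight (r i) (supp E)) atTop (𝓝 0) := by
  have ht := rsc_st_tendsto_sum_indepWeight_oddResidual hν hC hT D hD r hρ0 hr0 hrρ hρ h4
  have hw : ∀ i E, 0 ≤ indepWeight (r i) (supp E) := fun i E =>
    indepWeight_nonneg (hr0 i) (fun ℓ => (hrρ i ℓ).trans (by linarith)) _
  refine squeeze_zero' (Filter.Eventually.of_forall fun i => Finset.sum_nonneg fun E _ => hw i E)
    (Filter.Eventually.of_forall fun i => ?_) ht
  refine Finset.sum_le_sum_of_subset_of_nonneg (fun E hE => ?_) fun E _ _ => hw i E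
  rw [Finset.mem_filter] at hE ⊢
  exact ⟨Finset.mem_univ _, oddResidual_of_not_corrects_X (by omega) (T i) (hD i) hE.2⟩

open Classical in
/-- **`H_X` sector, inhomogeneous space-time noise, from any bound on `μ(ℤ³)`**: `μ(ℤ³) ≤ μ'` (`μ' ≥ 1`), all rates
`≤ ρ < p₀(μ')` ⇒ failure sums `→ 0`. [cite: DennisEtAl2002, §5.3 eqs. (saw_3), (threshold_iso_num)] -/
theorem rsc_z_stInhom_belowThreshold_of_connectiveConstant_three_le {μ' : ℝ} (hμ'1 : 1 ≤ μ')
    (hμ : SAW.Zd.connectiveConstant 3 ≤ μ') {T : ℕ → ℕ} (hT : IsPolyBounded T)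
    (D : ∀ i, CSSPhenom.STDecoder (Fin (i + 1 + 1) × Fin (i + 1 - 1)) (Fin (i + 1) × Fin (i + 1)) (T i))
    (hD : ∀ i, (D i).IsMinWeight (CSSPhenom.stSyn (rscCode i).HX (T i)) (CSSPhenom.stCycles (rscCode i).HX (T i))
      hammingNorm)
    (r : ∀ i, HistoryLoc (Fin (i + 1) × Fin (i + 1)) (Fin (i + 1 + 1) × Fin (i + 1 - 1)) (T i) → ℝ) {ρ : ℝ}
    (hρ0 : 0 ≤ ρ) (hr0 : ∀ i ℓ, 0 ≤ r i ℓ) (hrρ : ∀ i ℓ, r i ℓ ≤ ρ) (hρ : ρ < thresholdValue μ') :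
    Tendsto (fun i => ∑ E ∈ univ.filter (fun E : CSSPhenom.History (Fin (i + 1 + 1) × Fin (i + 1 - 1))
        (Fin (i + 1) × Fin (i + 1)) (T i) => ¬ (D i).Corrects (CSSPhenom.stSyn (rscCode i).HX (T i))
          (CSSPhenom.stTrivial ((rscCode i).rowSpZ : Set (Fin (i + 1) × Fin (i + 1) → ZMod 2)) (T i)) E),
        indepWeight (r i) (supp E)) atTop (𝓝 0) := by
  have hρh : ρ ≤ 1 / 2 := hρ.le.trans (thresholdValue_le_half μ')
  obtain ⟨ν, hν, h4⟩ := exists_gt_four_mul_sq_lt_one_of_lt_thresholdValue hμ'1 hρ0 hρ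
  obtain ⟨C, hC⟩ := exists_sawCountBound3_of_connectiveConstant_lt (lt_of_le_of_lt hμ hν)
  exact rsc_z_stInhom_belowThreshold_of_sawCountBound3 (by linarith) hC hT D hD r hρ0 hr0 hrρ hρh h4

open Classical in
/-- ★ **`H_X` sector: all space-time fault rates `≤ ρ < p₀(4.7476)` ⇒ failure sums `→ 0`** (every size, every polynomially
bounded schedule, every minimum-weight space-time decoder family, every rate field) — UNCONDITIONAL, tier CERTIFIED (kernel).
[cite: DennisEtAl2002, §5.3 eq. (threshold_iso_num)] [cite: PonitzTittmann2000, Table 2 (d = 3, k = 12)] -/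
theorem rsc_z_stInhom_belowThreshold_kernelZ3SymmK12 {T : ℕ → ℕ} (hT : IsPolyBounded T)
    (D : ∀ i, CSSPhenom.STDecoder (Fin (i + 1 + 1) × Fin (i + 1 - 1)) (Fin (i + 1) × Fin (i + 1)) (T i))
    (hD : ∀ i, (D i).IsMinWeight (CSSPhenom.stSyn (rscCode i).HX (T i)) (CSSPhenom.stCycles (rscCode i).HX (T i))
      hammingNorm)
    (r : ∀ i, HistoryLoc (Fin (i + 1) × Fin (i + 1)) (Fin (i + 1 + 1) × Fin (i + 1 - 1)) (T i) → ℝ) {ρ : ℝ}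
    (hρ0 : 0 ≤ ρ) (hr0 : ∀ i ℓ, 0 ≤ r i ℓ) (hrρ : ∀ i ℓ, r i ℓ ≤ ρ) (hρ : ρ < thresholdValue 4.7476) :
    Tendsto (fun i => ∑ E ∈ univ.filter (fun E : CSSPhenom.History (Fin (i + 1 + 1) × Fin (i + 1 - 1))
        (Fin (i + 1) × Fin (i + 1)) (T i) => ¬ (D i).Corrects (CSSPhenom.stSyn (rscCode i).HX (T i))
          (CSSPhenom.stTrivial ((rscCode i).rowSpZ : Set (Fin (i + 1) × Fin (i + 1) → ZMod 2)) (T i)) E),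
        indepWeight (r i) (supp E)) atTop (𝓝 0) :=
  rsc_z_stInhom_belowThreshold_of_connectiveConstant_three_le (by norm_num)
    SAW.Zd.FiniteMemory3.connectiveConstant_three_le_47476 hT D hD r hρ0 hr0 hrρ hρ

/-! ### `H_Z` sector -/

open Classical in
/-- **`H_Z` sector, inhomogeneous space-time noise: failure sums `→ 0` when `4ν² ρ(1-ρ) < 1`** (same hypotheses, `Z`-check
record of `RSC(i+1)`). [cite: DennisEtAl2002, §5.3 eq. (threshold_iso) with §5.2 eq. (28)] -/
theorem rsc_x_stInhom_belowThreshold_of_sawCountBound3 {C ν : ℝ} (hν : 0 < ν) (hC : SAWCountBound3 C ν) {T : ℕ → ℕ}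
    (hT : IsPolyBounded T)
    (D : ∀ i, CSSPhenom.STDecoder (Fin (i + 1 - 1) × Fin (i + 1 + 1)) (Fin (i + 1) × Fin (i + 1)) (T i))
    (hD : ∀ i, (D i).IsMinWeight (CSSPhenom.stSyn (rscCode i).HZ (T i)) (CSSPhenom.stCycles (rscCode i).HZ (T i))
      hammingNorm)
    (r : ∀ i, HistoryLoc (Fin (i + 1) × Fin (i + 1)) (Fin (i + 1 - 1) × Fin (i + 1 + 1)) (T i) → ℝ) {ρ : ℝ}
    (hρ0 : 0 ≤ ρ) (hr0 : ∀ i ℓ, 0 ≤ r i ℓ) (hrρ : ∀ i ℓ, r i ℓ ≤ ρ) (hρ : ρ ≤ 1 / 2)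
    (h4 : 4 * ν ^ 2 * (ρ * (1 - ρ)) < 1) :
    Tendsto (fun i => ∑ E ∈ univ.filter (fun E : CSSPhenom.History (Fin (i + 1 - 1) × Fin (i + 1 + 1))
        (Fin (i + 1) × Fin (i + 1)) (T i) => ¬ (D i).Corrects (CSSPhenom.stSyn (rscCode i).HZ (T i))
          (CSSPhenom.stTrivial ((rscCode i).rowSpX : Set (Fin (i + 1) × Fin (i + 1) → ZMod 2)) (T i)) E),
        indepWeight (r i) (supp E)) atTop (𝓝 0) := by
  have ht := rsc_stZ_tendsto_sum_indepWeight_oddResidual hν hC hT D hD r hρ0 hr0 hrρ hρ h4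
  have hw : ∀ i E, 0 ≤ indepWeight (r i) (supp E) := fun i E =>
    indepWeight_nonneg (hr0 i) (fun ℓ => (hrρ i ℓ).trans (by linarith)) _
  refine squeeze_zero' (Filter.Eventually.of_forall fun i => Finset.sum_nonneg fun E _ => hw i E)
    (Filter.Eventually.of_forall fun i => ?_) ht
  refine Finset.sum_le_sum_of_subset_of_nonneg (fun E hE => ?_) fun E _ _ => hw i E
  rw [Finset.mem_filter] at hE ⊢
  exact ⟨Finset.mem_univ _, oddResidual_of_not_corrects_Z (by omega) (T i) (hD i) hE.2⟩

open Classical in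
/-- **`H_Z` sector, from any bound on `μ(ℤ³)`**: all rates `≤ ρ < p₀(μ')` ⇒ failure sums `→ 0`.
[cite: DennisEtAl2002, §5.3 eqs. (saw_3), (threshold_iso_num)] -/
theorem rsc_x_stInhom_belowThreshold_of_connectiveConstant_three_le {μ' : ℝ} (hμ'1 : 1 ≤ μ')
    (hμ : SAW.Zd.connectiveConstant 3 ≤ μ') {T : ℕ → ℕ} (hT : IsPolyBounded T)
    (D : ∀ i, CSSPhenom.STDecoder (Fin (i + 1 - 1) × Fin (i + 1 + 1)) (Fin (i + 1) × Fin (i + 1)) (T i))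
    (hD : ∀ i, (D i).IsMinWeight (CSSPhenom.stSyn (rscCode i).HZ (T i)) (CSSPhenom.stCycles (rscCode i).HZ (T i))
      hammingNorm)
    (r : ∀ i, HistoryLoc (Fin (i + 1) × Fin (i + 1)) (Fin (i + 1 - 1) × Fin (i + 1 + 1)) (T i) → ℝ) {ρ : ℝ}
    (hρ0 : 0 ≤ ρ) (hr0 : ∀ i ℓ, 0 ≤ r i ℓ) (hrρ : ∀ i ℓ, r i ℓ ≤ ρ) (hρ : ρ < thresholdValue μ') :
    Tendsto (fun i => ∑ E ∈ univ.filter (fun E : CSSPhenom.History (Fin (i + 1 - 1) × Fin (i + 1 + 1))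
        (Fin (i + 1) × Fin (i + 1)) (T i) => ¬ (D i).Corrects (CSSPhenom.stSyn (rscCode i).HZ (T i))
          (CSSPhenom.stTrivial ((rscCode i).rowSpX : Set (Fin (i + 1) × Fin (i + 1) → ZMod 2)) (T i)) E),
        indepWeight (r i) (supp E)) atTop (𝓝 0) := by
  have hρh : ρ ≤ 1 / 2 := hρ.le.trans (thresholdValue_le_half μ')
  obtain ⟨ν, hν, h4⟩ := exists_gt_four_mul_sq_lt_one_of_lt_thresholdValue hμ'1 hρ0 hρ
  obtain ⟨C, hC⟩ := exists_sawCountBound3_of_connectiveConstant_lt (lt_of_le_of_lt hμ hν)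
  exact rsc_x_stInhom_belowThreshold_of_sawCountBound3 (by linarith) hC hT D hD r hρ0 hr0 hrρ hρh h4

open Classical in
/-- ★ **`H_Z` sector: all space-time fault rates `≤ ρ < p₀(4.7476)` ⇒ failure sums `→ 0`** — UNCONDITIONAL, tier CERTIFIED
(kernel). [cite: DennisEtAl2002, §5.3 eq. (threshold_iso_num)] [cite: PonitzTittmann2000, Table 2 (d = 3, k = 12)] -/
theorem rsc_x_stInhom_belowThreshold_kernelZ3SymmK12 {T : ℕ → ℕ} (hT : IsPolyBounded T)
    (D : ∀ i, CSSPhenom.STDecoder (Fin (i + 1 - 1) × Fin (i + 1 + 1)) (Fin (i + 1) × Fin (i + 1)) (T i))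
    (hD : ∀ i, (D i).IsMinWeight (CSSPhenom.stSyn (rscCode i).HZ (T i)) (CSSPhenom.stCycles (rscCode i).HZ (T i))
      hammingNorm)
    (r : ∀ i, HistoryLoc (Fin (i + 1) × Fin (i + 1)) (Fin (i + 1 - 1) × Fin (i + 1 + 1)) (T i) → ℝ) {ρ : ℝ}
    (hρ0 : 0 ≤ ρ) (hr0 : ∀ i ℓ, 0 ≤ r i ℓ) (hrρ : ∀ i ℓ, r i ℓ ≤ ρ) (hρ : ρ < thresholdValue 4.7476) :
    Tendsto (fun i => ∑ E ∈ univ.filter (fun E : CSSPhenom.History (Fin (i + 1 - 1) × Fin (i + 1 + 1))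
        (Fin (i + 1) × Fin (i + 1)) (T i) => ¬ (D i).Corrects (CSSPhenom.stSyn (rscCode i).HZ (T i))
          (CSSPhenom.stTrivial ((rscCode i).rowSpX : Set (Fin (i + 1) × Fin (i + 1) → ZMod 2)) (T i)) E),
        indepWeight (r i) (supp E)) atTop (𝓝 0) :=
  rsc_x_stInhom_belowThreshold_of_connectiveConstant_three_le (by norm_num)
    SAW.Zd.FiniteMemory3.connectiveConstant_three_le_47476 hT D hD r hρ0 hr0 hrρ hρ

/-! ### Both records, decimal -/

open Classical in
/-- **Both records of the rotated memory experiment under inhomogeneous space-time noise with all rates `≤ .0112`**: the two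
failure sums tend to `0` for every polynomially bounded schedule, every pair of minimum-weight space-time decoder families and every
pair of rate fields `rZ i`, `rX i` on the fault locations of the two records with values in `[0, .0112]` — UNCONDITIONAL, tier
CERTIFIED (kernel). [cite: DennisEtAl2002, §4.1 (X and Z errors corrected separately) and §5.3 eq. (threshold_iso_num)] -/
theorem rsc_stInhom_bothSectors_belowThreshold_0112 {T : ℕ → ℕ} (hT : IsPolyBounded T)
    (DZ : ∀ i, CSSPhenom.STDecoder (Fin (i + 1 + 1) × Fin (i + 1 - 1)) (Fin (i + 1) × Fin (i + 1)) (T i))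
    (hDZ : ∀ i, (DZ i).IsMinWeight (CSSPhenom.stSyn (rscCode i).HX (T i)) (CSSPhenom.stCycles (rscCode i).HX (T i))
      hammingNorm)
    (DX : ∀ i, CSSPhenom.STDecoder (Fin (i + 1 - 1) × Fin (i + 1 + 1)) (Fin (i + 1) × Fin (i + 1)) (T i))
    (hDX : ∀ i, (DX i).IsMinWeight (CSSPhenom.stSyn (rscCode i).HZ (T i)) (CSSPhenom.stCycles (rscCode i).HZ (T i))
      hammingNorm)
    (rZ : ∀ i, HistoryLoc (Fin (i + 1) × Fin (i + 1)) (Fin (i + 1 + 1) × Fin (i + 1 - 1)) (T i) → ℝ)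
    (rX : ∀ i, HistoryLoc (Fin (i + 1) × Fin (i + 1)) (Fin (i + 1 - 1) × Fin (i + 1 + 1)) (T i) → ℝ)
    (hrZ0 : ∀ i ℓ, 0 ≤ rZ i ℓ) (hrZ : ∀ i ℓ, rZ i ℓ ≤ 0.0112) (hrX0 : ∀ i ℓ, 0 ≤ rX i ℓ) (hrX : ∀ i ℓ, rX i ℓ ≤ 0.0112) :
    Tendsto (fun i => ∑ E ∈ univ.filter (fun E : CSSPhenom.History (Fin (i + 1 + 1) × Fin (i + 1 - 1))
        (Fin (i + 1) × Fin (i + 1)) (T i) => ¬ (DZ i).Corrects (CSSPhenom.stSyn (rscCode i).HX (T i))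
          (CSSPhenom.stTrivial ((rscCode i).rowSpZ : Set (Fin (i + 1) × Fin (i + 1) → ZMod 2)) (T i)) E),
        indepWeight (rZ i) (supp E)) atTop (𝓝 0) ∧
      Tendsto (fun i => ∑ E ∈ univ.filter (fun E : CSSPhenom.History (Fin (i + 1 - 1) × Fin (i + 1 + 1))
        (Fin (i + 1) × Fin (i + 1)) (T i) => ¬ (DX i).Corrects (CSSPhenom.stSyn (rscCode i).HZ (T i))
          (CSSPhenom.stTrivial ((rscCode i).rowSpX : Set (Fin (i + 1) × Fin (i + 1) → ZMod 2)) (T i)) E),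
        indepWeight (rX i) (supp E)) atTop (𝓝 0) := by
  have h := thresholdValue_47476_bounds.1
  exact ⟨rsc_z_stInhom_belowThreshold_kernelZ3SymmK12 hT DZ hDZ rZ (by norm_num) hrZ0 hrZ (by linarith),
    rsc_x_stInhom_belowThreshold_kernelZ3SymmK12 hT DX hDX rX (by norm_num) hrX0 hrX (by linarith)⟩

end Summit.Ventures.QEC.Thresholds
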